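import Literature.Barriers.HodgeConjecture.ConjugateVarietiesSerreAssemblyProofs
import HarnessLib

/-!
# Serre 1964 ⇐ the existence of Serre's variety with its two torus models (fact split)

Topic `Literature/Barriers/HodgeConjecture`. Fact-decomposition file (librarian, mode
`fact-decompose`, 2026-08-16) for the barrier fact
`Literature.Barriers.HodgeConjecture.Serre1964_conjugateVarieties_notHomeomorphic`
(`ConjugateVarieties.lean`; J.-P. Serre, *Exemples de variétés projectives conjuguées non
homéomorphes*, C. R. Acad. Sci. Paris 258 (1964) 4194–4196, Théorème p. 4196, in the `Aut(ℂ)`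
form of Charles 2009 §1 / Charles–Schnell §11.2.5).

The tree has PROVED every group-theoretic and topological step of Serre's note and the passage
from Serre's number-field form to the vendored `Aut(ℂ)` form (`ConjugateVarietiesProofs.lean`,
`…SerreProofs.lean` — the algebraic half `Serre1964.isEmpty_mulEquiv_numberField`,
`…SerreTopologyProofs.lean` — orbit spaces of the two shapes are not homeomorphic,
`…SerreArithmeticProofs.lean`, `…SerreFermat*.lean`, `…SerreTwentyThreeProofs.lean`), assembled as
`serre1964_of_torusModels` (`ConjugateVarietiesSerreAssemblyProofs.lean`): **the fact holds as soon
as the complex points `V_φ(ℂ)`, `V_ψ(ℂ)` of ONE smooth projective variety `V` over a number field,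
under two complex embeddings, are homeomorphic to orbit spaces `(Y × W/Λ)/G` of Serre's shape with
lattices `Λ₁ ≅ 𝓞_{ℚ(ζ_p)}` and `Λ₂ ≅ 𝔟 𝓞_{ℚ(ζ_p)}` (`𝔟` non-principal)**.  What remains is pure
algebraic geometry / analytic uniformisation: Serre's construction "Nous prendrons comme variété `V`
le quotient de `Y × A` par `G`" over the Hilbert class field of `ℚ(√-p)` and the description of its
complex points — no. 1 (the abelian variety `A = E^{(p-1)/2}` with complex multiplication, whose
period lattice under `φ` is free over `𝓞_{ℚ(ζ_p)}` and under `ψ` is `𝔟`-twisted, by the main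
theorem of complex multiplication), no. 2 (the simply connected hypersurface `Y` with free
`ℤ/p`-action, Lefschetz), and GAGA for the quotient.

This file NAMES that remaining input as ONE existential child,
`Serre1964_exists_conjugateTorusModels` (the data and hypotheses of `serre1964_of_torusModels`,
bundled), and records the PROVED assembly.  The child is an existence statement about a variety
over a number field and explicit topological models of its complex points — not a restatement of
the parent (which speaks of `X^σ` for `σ ∈ Aut(ℂ)` and of non-homeomorphy); `k = 1` because all
other parts of the printed proof are theorems of the tree.

## References

* [Serre1964Conjugate] J.-P. Serre, C. R. Acad. Sci. Paris 258 (1964) 4194–4196 (= *Œuvres* II,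
  no. 63): nos. 1–2, Lemmes 1–2, Théorème p. 4196.
* [Charles2009Conjugate] F. Charles, J. reine angew. Math. 630 (2009) 125–139, §1.
-/

noncomputable section

namespace Literature.Barriers.HodgeConjecture

open NumberField Multiplicative Literature.AlgebraicGeometry.Motives
open Literature.AlgebraicTopology.FundamentalGroup

/-- **Serre 1964, nos. 1–2: Serre's variety and the torus models of its two complexifications
exist.**  There are: a prime `p`, the cyclotomic field `K₀ = ℚ(ζ_p)` with a primitive `p`-th root
of unity `ζ`, a subfield `k ⊆ K₀` (Serre: `k = ℚ(√-p)`, `p ≡ 3 mod 4`) with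
`([K₀ : k], h_k) = 1` and a NON-principal ideal `𝔟 ⊂ 𝓞_k` (so `h_k > 1`; Serre: `p = 23`); two
topological models `(Yᵢ × Vᵢ/Λᵢ)/Gᵢ` (`i = 1, 2`) — `Yᵢ` simply connected, locally compact,
Hausdorff (no. 2: a smooth hypersurface `Y ⊂ ℙ_{p-1}` with free `G = ℤ/p`-action, simply
connected by Lefschetz), `Vᵢ/Λᵢ` quotients of simply connected commutative topological groups by
discrete subgroups with `Λ₁ ≅ (𝓞_{K₀}, +)` and `Λ₂ ≅ (𝔟 𝓞_{K₀}, +)` (no. 1: the period lattices of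
`A_φ`, `A_ψ` for `A = E^{(p-1)/2}`, `E` with complex multiplication by `𝓞_k`, "le premier est
libre, le second ne l'est pas"), a continuous additive `Mᵢ` preserving `Λᵢ` and acting on it as
multiplication by `ζ` ("`S` opère sur `A`"), and free continuous actions of groups `Gᵢ` of order
`p` on `Yᵢ × Vᵢ/Λᵢ` containing an element acting on the torus factor as the map induced by `Mᵢ`;
and a smooth projective variety `V` over a number field `K` (Serre: the Hilbert class field of
`k`, `V = (Y × A)/G`) with two embeddings `φ, ψ : K → ℂ` and HOMEOMORPHISMS
`V_φ(ℂ) ≃ₜ (Y₁ × V₁/Λ₁)/G₁`, `V_ψ(ℂ) ≃ₜ (Y₂ × V₂/Λ₂)/G₂` (complex points of the base changes,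
`ComplexPoints ((baseChangeHom φ).obj V)`; by GAGA and the uniformisation of CM abelian varieties).
These are exactly the data and hypotheses of the tree's `serre1964_of_torusModels`, bundled into
one existential (all types in `Type`). [cite: Serre1964Conjugate, nos. 1–2 and Théorème p. 4196] -/
def Serre1964_exists_conjugateTorusModels : Prop :=
  ∃ (p : ℕ) (_ : Fact p.Prime) (K₀ : Type) (_ : Field K₀) (_ : NumberField K₀)
    (_ : IsCyclotomicExtension {p} ℚ K₀) (ζ : K₀) (hζ : IsPrimitiveRoot ζ p)
    (k : Type) (_ : Field k) (_ : NumberField k) (_ : Algebra k K₀)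
    (𝔟 : Ideal (𝓞 k)) (_ : 𝔟 ≠ ⊥) (_ : ¬ 𝔟.IsPrincipal)
    (_ : Nat.Coprime (Module.finrank k K₀) (Fintype.card (ClassGroup (𝓞 k))))
    -- model 1
    (Y₁ V₁ G₁ : Type) (_ : TopologicalSpace Y₁) (_ : SimplyConnectedSpace Y₁)
    (_ : LocallyCompactSpace Y₁) (_ : T2Space Y₁) (_ : AddCommGroup V₁) (_ : TopologicalSpace V₁)
    (_ : IsTopologicalAddGroup V₁) (_ : SimplyConnectedSpace V₁) (Λ₁ : AddSubgroup V₁)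
    (_ : IsDiscrete (Λ₁ : Set V₁)) (_ : LocallyCompactSpace (V₁ ⧸ Λ₁)) (_ : T2Space (V₁ ⧸ Λ₁))
    (M₁ : V₁ →+ V₁) (hM₁c : Continuous M₁) (hM₁ : ∀ v ∈ Λ₁, M₁ v ∈ Λ₁)
    (ε₁ : 𝓞 K₀ ≃+ Λ₁) (_ : ∀ s : 𝓞 K₀, ((ε₁ (hζ.toInteger * s) : Λ₁) : V₁) = M₁ (ε₁ s))
    (_ : Group G₁) (_ : Finite G₁) (_ : MulAction G₁ Y₁) (_ : MulAction G₁ (V₁ ⧸ Λ₁))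
    (_ : ContinuousConstSMul G₁ Y₁) (_ : ContinuousConstSMul G₁ (V₁ ⧸ Λ₁)) (_ : Nat.card G₁ = p)
    (_ : ∀ (g : G₁) (z : Y₁ × (V₁ ⧸ Λ₁)), g • z = z → g = 1) (g₁ : G₁)
    (_ : ∀ a : V₁ ⧸ Λ₁, g₁⁻¹ • a = torusMap Λ₁ M₁ hM₁c hM₁ a)
    -- model 2
    (Y₂ V₂ G₂ : Type) (_ : TopologicalSpace Y₂) (_ : SimplyConnectedSpace Y₂)
    (_ : LocallyCompactSpace Y₂) (_ : T2Space Y₂) (_ : AddCommGroup V₂) (_ : TopologicalSpace V₂)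
    (_ : IsTopologicalAddGroup V₂) (_ : SimplyConnectedSpace V₂) (Λ₂ : AddSubgroup V₂)
    (_ : IsDiscrete (Λ₂ : Set V₂)) (_ : LocallyCompactSpace (V₂ ⧸ Λ₂)) (_ : T2Space (V₂ ⧸ Λ₂))
    (M₂ : V₂ →+ V₂) (hM₂c : Continuous M₂) (hM₂ : ∀ v ∈ Λ₂, M₂ v ∈ Λ₂)
    (ε₂ : ↥(𝔟.map (algebraMap (𝓞 k) (𝓞 K₀))) ≃+ Λ₂)
    (_ : ∀ b : ↥(𝔟.map (algebraMap (𝓞 k) (𝓞 K₀))),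
      ((ε₂ (hζ.toInteger • b) : Λ₂) : V₂) = M₂ (ε₂ b))
    (_ : Group G₂) (_ : Finite G₂) (_ : MulAction G₂ Y₂) (_ : MulAction G₂ (V₂ ⧸ Λ₂))
    (_ : ContinuousConstSMul G₂ Y₂) (_ : ContinuousConstSMul G₂ (V₂ ⧸ Λ₂)) (_ : Nat.card G₂ = p)
    (_ : ∀ (g : G₂) (z : Y₂ × (V₂ ⧸ Λ₂)), g • z = z → g = 1) (g₂ : G₂)
    (_ : ∀ a : V₂ ⧸ Λ₂, g₂⁻¹ • a = torusMap Λ₂ M₂ hM₂c hM₂ a)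
    -- the variety and the two homeomorphisms with the models
    (K : Type) (_ : Field K) (_ : NumberField K) (n : ℕ) (V : SchemeOver K)
    (_ : IsSmoothProjective n V) (φ ψ : K →+* ℂ),
    Nonempty (ComplexPoints ((baseChangeHom φ).obj V) ≃ₜ
        MulAction.orbitRel.Quotient G₁ (Y₁ × (V₁ ⧸ Λ₁))) ∧
      Nonempty (ComplexPoints ((baseChangeHom ψ).obj V) ≃ₜ
        MulAction.orbitRel.Quotient G₂ (Y₂ × (V₂ ⧸ Λ₂)))

/-- **Assembly (fact split): Serre's theorem from the existence of his variety with its torus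
models** — unpack the witnesses and apply the tree's `serre1964_of_torusModels` (algebraic half,
topological half and the number-field-to-`Aut(ℂ)` passage all proved).
[cite: Serre1964Conjugate, Théorème p. 4196] -/
theorem Serre1964_conjugateVarieties_notHomeomorphic_holds_of
    (h : Serre1964_exists_conjugateTorusModels) :
    Serre1964_conjugateVarieties_notHomeomorphic := by
  obtain ⟨p, _, K₀, _, _, _, ζ, hζ, k, _, _, _, 𝔟, h𝔟0, h𝔟, hcop,
    Y₁, V₁, G₁, _, _, _, _, _, _, _, _, Λ₁, hΛ₁, _, _, M₁, hM₁c, hM₁, ε₁, hε₁,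
    _, _, _, _, _, _, hG₁, hfree₁, g₁, hg₁,
    Y₂, V₂, G₂, _, _, _, _, _, _, _, _, Λ₂, hΛ₂, _, _, M₂, hM₂c, hM₂, ε₂, hε₂,
    _, _, _, _, _, _, hG₂, hfree₂, g₂, hg₂,
    K, _, _, n, V, hV, φ, ψ, ⟨eφ⟩, ⟨eψ⟩⟩ := h
  exact serre1964_of_torusModels hζ h𝔟0 h𝔟 hcop Λ₁ hΛ₁ M₁ hM₁c hM₁ ε₁ hε₁ hG₁ hfree₁ g₁ hg₁
    Λ₂ hΛ₂ M₂ hM₂c hM₂ ε₂ hε₂ hG₂ hfree₂ g₂ hg₂ hV φ ψ eφ eψ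

end Literature.Barriers.HodgeConjecture

end
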